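import Mathlib
import HarnessLib
import Summits.ValiantsHypothesis.ValiantsHypothesis.Theses.MonotoneRestoration
import Literature.Computability.AlgebraicComplexity.ArithCircuit
import Literature.Computability.AlgebraicComplexity.ArithCircuitProofs
import Literature.Computability.AlgebraicComplexity.MonotoneStructure
import Literature.Computability.AlgebraicComplexity.PermanentIrreducible
import Literature.ModelTheory.FiniteModelTheory.CkEquiv
import Summits.ValiantsHypothesis.ValiantsHypothesis.Theorems.MonotoneRestorationMonotoneRestorationQPCosetCount
import Summits.ValiantsHypothesis.ValiantsHypothesis.Theorems.MonotoneRestorationMonotoneRestorationQPSymmetricLB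
import Summits.ValiantsHypothesis.ValiantsHypothesis.Theorems.MonotoneRestorationMonotoneRestorationQPSupportSymmetrisation
import Summits.ValiantsHypothesis.ValiantsHypothesis.Theorems.MonotoneRestorationMonotoneRestorationQPSparseRegime
import Summits.ValiantsHypothesis.ValiantsHypothesis.Theorems.MonotoneRestorationMonotoneRestorationQPBeta
import Literature.Computability.AlgebraicComplexity.SymmetricArithCircuit
import Literature.Computability.AlgebraicComplexity.DawarWilsenach2025Proofs
import Literature.GroupTheory.PermutationGroups.SmallIndexSubgroups
import Summits.ValiantsHypothesis.ValiantsHypothesis.Theorems.MonotoneRestorationQP.Negative.LoadBearing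
import Summits.ValiantsHypothesis.ValiantsHypothesis.Theorems.MonotoneRestorationMonotoneRestorationQPPermSupportCount

/-! TTRL-lite variant V14560 of stmt-ValiantsHypothesis-15886 -/

-- `Summit.ValiantsHypothesis.ValiantsHypothesis.…` is the tree's mandated single-conjunct layout
-- (Sub = Summit), so the duplicated namespace component is intended.
set_option linter.dupNamespace false

namespace Summit.ValiantsHypothesis.ValiantsHypothesis.Theorems

open Summit.ValiantsHypothesis.ValiantsHypothesis.Theses.MonotoneRestoration
open Literature.Computability.AlgebraicComplexity

/-- **TTRL-lite variant V14560** (`conj:0` of `stub_esymmRowSums_structure`,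
stmt-ValiantsHypothesis-15886): the elementary symmetric polynomial of degree `⌊n/2⌋` in the
row sums `R_i = Σ_j x_{i,j}` of the `n × n` variable matrix, over `ℝ≥0`, is homogeneous of
degree `⌊n/2⌋`. Proof: `e_k` is homogeneous of degree `k` (sum over `k`-subsets of products of
`k` variables), each row sum is homogeneous of degree `1`, and `bind₁ = aeval` of a homogeneous
polynomial at homogeneous degree-one forms is homogeneous of degree `1 * k`
(`MvPolynomial.IsHomogeneous.aeval`). [folklore] -/
theorem stub_esymmRowSums_structure_var14560 :
    ∀ (n : ℕ), (MvPolynomial.bind₁ (fun i : Fin n => ∑ j : Fin n, MvPolynomial.X (i, j))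
      (MvPolynomial.esymm (Fin n) NNReal (n / 2))).IsHomogeneous (n / 2) := by
  classical
  intro n
  -- `e_k` is homogeneous of degree `k`.
  have hes : ∀ k : ℕ, (MvPolynomial.esymm (Fin n) NNReal k).IsHomogeneous k := by
    intro k
    rw [MvPolynomial.esymm]
    refine MvPolynomial.IsHomogeneous.sum _ _ _ fun t ht => ?_
    have hcard : t.card = k := (Finset.mem_powersetCard.1 ht).2
    have h := MvPolynomial.IsHomogeneous.prod t
      (fun i => (MvPolynomial.X i : MvPolynomial (Fin n) NNReal)) (fun _ => 1)
      fun i _ => MvPolynomial.isHomogeneous_X NNReal i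
    simpa [hcard] using h
  -- Each row sum is homogeneous of degree `1`.
  have hrow : ∀ i : Fin n, (∑ j : Fin n,
      (MvPolynomial.X (i, j) : MvPolynomial (Fin n × Fin n) NNReal)).IsHomogeneous 1 :=
    fun i => MvPolynomial.IsHomogeneous.sum _ _ _ fun j _ => MvPolynomial.isHomogeneous_X _ _
  -- Substitute: `bind₁ R (e_k) = aeval R (e_k)` is homogeneous of degree `1 * k`.
  have h := (hes (n / 2)).aeval _ hrow
  simpa only [MvPolynomial.aeval_eq_bind₁, one_mul] using h

end Summit.ValiantsHypothesis.ValiantsHypothesis.Theorems
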